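import Summits.BirchSwinnertonDyer.BirchSwinnertonDyer.Theorems.EisensteinPrimesAnalyticLambdaAbsoluteCount
import Literature.Barriers.BirchSwinnertonDyer.EisensteinMuConjecture
import HarnessLib

/-!
# Route `EisensteinPrimes`, line `mudescent`, cruxes 3/5: the MAZUR TWIN FAMILY predicate
# (DEFINITIONS ONLY + their unfolding / bookkeeping lemmas; helper for `stub_lambdaCount_offLocus`)

Seat `bsd-eis-lam-a` g11 (PROGRAMME PART 1b, ACCEL-LIST (4): ANALYTIC side of
`stub_lambdaCount_offLocus`; items stmt-BirchSwinnertonDyer-19033 / -19035; skeleton owner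
bsd-eis-ky). Filed on the planner's RULING L100 (1) (HOME/bsd-eis STATUS l.2237): the typed objects
(α) of lam-a MEMO-10 §5 — verbatim from `HOME/lam-a-g10/MazurTwinFamily.scratch.lean` — so that the
planner can file the paper theorems B′/B⁺ (MEMO-10 §2) as `aside` items of the route and the crux
lead can register the sub-stub `stub_lambdaCount_twinFamily` BY NAME. No theorem about any curve is
asserted here; nothing closes; no label moves.

CONTENTS.
* `MazurGoodAt p q` — Mazur's «`p` is a good prime for `(p, q)`» with `ℓ = p`: `p` is NOT a `p`-th
  power modulo `q` (Mazur 1977 II §16 Def.; III Cor. (8.5): the cuspidal-normalised `𝔓`-adic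
  `L`-series `η⁻¹·L_𝔓(χ₀,T)` of `J₀(q)` is a unit of `T_𝔓⟦T⟧` iff this holds).
* `MazurTwinFamilyAt W p q` — the hypotheses ON THE CURVE of MEMO-10 THEOREM B′/B⁺: squarefree
  conductor `N`; `q ∣ N` a prime `≠ p` of Eisenstein type (`q ≡ 1 (mod p)`, and `≡ 1 (mod 9)` when
  `p = 3`, i.e. `p ∣ num((q−1)/12)`); `W` is the ÉTALE END of its class (`p ∣ #E(ℚ)_tors` and no
  ramified odd line, tree `HasRamifiedOddLineAt`); `E[p]` is ramified at `q` (`p ∤ v_q(Δ)`) and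
  unramified at every other `ℓ ∣ N`, `ℓ ≠ p` (`p ∣ v_ℓ(Δ)`, hypothesis (Ram_q)); and at `p = 3`
  Yoo's hypothesis (Y): some prime `≡ 2 (mod 3)` divides `N`. All clauses are decidable from
  Cremona's data of the curve.
* `splitPrimesOutside W p q` — the RAISING SET of THEOREM B′: the prime divisors `ℓ` of `N` with
  `ℓ ∉ {p, q}` at which `W` has split multiplicative reduction; THEOREM B′ reads
  `λ_an(W) = Σ_{ℓ ∈ splitPrimesOutside W p q} sFactor p ℓ`.
* Unfolding lemmas (`Iff.rfl`) and the bookkeeping fact the `Λ`-sockets of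
  `EisensteinPrimesAnalyticLambdaAbsoluteCount` / `…NonUnitCount` / `…CompositeCount` consume:
  `coprime_and_one_lt_of_mem_splitPrimesOutside` — every `ℓ ∈ splitPrimesOutside W p q` is a prime
  `≠ p`, hence `p.Coprime ℓ ∧ 1 < ℓ` (their hypothesis `hS`).

WHAT IS NOT HERE. The statements «THEOREM B′ (X2/X1 currency)» themselves (MEMO-10 §5 (β):
`MazurTwinFamilyAt W p q → MazurGoodAt p q → X2.AnalyticMuLE W p 0 ∧ X2.AnalyticLambdaEq W p
(Σ_{ℓ ∈ splitPrimesOutside W p q} sFactor p ℓ)`) are OUR results on paper (PRE-grade) and are the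
planner's to file as route items (RULING L100 (2)); they are deliberately not declared in this file.

References: [Mazur1977] II §16 Def. (p. 124), II Thm. (18.10), III Cor. (8.5) + Remark (p. 166);
[GreenbergVatsal2000] §1 (9)–(10) (`sFactor`); HOME/lam-a-g10/lam-a-MEMO-10.md §2, §5.
-/

set_option linter.dupNamespace false
set_option autoImplicit false

noncomputable section

open scoped Classical

open WeierstrassCurve Literature.NumberTheory.EllipticCurves
  Literature.NumberTheory.EllipticCurves.Rank1Residual
  Literature.NumberTheory.EllipticCurves.GreenbergVatsal2000
  Summit.BirchSwinnertonDyer.Rank1Residual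
  Literature.Barriers.BirchSwinnertonDyer

namespace Summit.BirchSwinnertonDyer.BirchSwinnertonDyer.Theorems.EisensteinPrimesMazurTwinFamily

/-! ## §1. Mazur's «good prime» condition at `ℓ = p` -/

/-- **Mazur's goodness of `p` for the pair `(p, q)`: `p` is not a `p`-th power modulo `q`.**
Mazur 1977 II §16 Def. (p. 124) calls a prime `ℓ ≠ q` *good* (relative to `(p, q)`, `p` odd) when
`ℓ` is not a `p`-th power modulo `q` (and, for `ℓ = 2`-type clauses irrelevant here); footnote (1)
p. 125 allows `ℓ = p`. By III Cor. (8.5) the cuspidal-normalised `𝔓`-adic `L`-series of `J₀(q)` at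
the `p`-Eisenstein prime is a unit of `T_𝔓⟦T⟧` iff `p` is good — the hypothesis (G) of MEMO-10
THEOREM B′. Junk: for `q = 0` this is a statement in `ZMod 0 = ℤ`; only prime `q` is ever used.
[cite: Mazur1977, II §16 Def. (p. 124); III Cor. (8.5)] -/
def MazurGoodAt (p q : ℕ) : Prop := ¬ ∃ x : ZMod q, x ^ p = (p : ZMod q)

/-- Unfolding lemma for `MazurGoodAt`. [cite: Mazur1977, II §16 Def. (p. 124)] -/
theorem mazurGoodAt_iff (p q : ℕ) : MazurGoodAt p q ↔ ∀ x : ZMod q, x ^ p ≠ (p : ZMod q) := by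
  simp [MazurGoodAt]

/-! ## §2. The Mazur twin family -/

/-- **The Mazur twin family at `(p, q)`** (MEMO-10 §2.1: the hypotheses of THEOREM B′/B⁺ on the
curve). `W` belongs to it when: its conductor `N` is squarefree; `q` is a prime, `q ≠ p`, `q ∣ N`,
of Eisenstein type — `q ≡ 1 (mod p)`, and `q ≡ 1 (mod 9)` when `p = 3` (together: `p ∣ num((q−1)/12)`,
so that `J₀(q)` has a `p`-Eisenstein prime, Mazur 1977 II (9.7)); `W` is the étale end of its isogeny
class — a rational point of order `p` (`p ∣ W.torsionOrder`) and NO ramified odd line in `E[p]`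
(`¬ HasRamifiedOddLineAt W p`, i.e. `E[p]` is the non-split extension of `μ_p` by `ℤ/p`); `E[p]` is
ramified at `q` (`p ∤ v_q(Δ)`, Tate) and unramified at every other bad prime `ℓ ≠ p`
(`p ∣ v_ℓ(Δ)` — hypothesis (Ram_q): `q` is the whole Kummer support); and, at `p = 3` only, Yoo's
hypothesis (Y): some prime `ℓ ≡ 2 (mod 3)` divides `N`. (`W.Δ` is the minimal discriminant because
`W` is globally minimal.) [cite: Mazur1977, II Prop. (9.7), III Cor. (8.5)] -/
def MazurTwinFamilyAt (W : WeierstrassCurve ℚ) [W.IsElliptic] [W.IsGloballyMinimal] (p q : ℕ)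
    [Fact p.Prime] : Prop :=
  Squarefree (W.conductorNorm ℤ) ∧ q.Prime ∧ q ≠ p ∧ q ∣ W.conductorNorm ℤ ∧
  (q : ZMod p) = 1 ∧ (p = 3 → (q : ZMod 9) = 1) ∧
  p ∣ W.torsionOrder ∧ ¬ HasRamifiedOddLineAt W p ∧
  ¬ ((p : ℤ) ∣ padicValRat q W.Δ) ∧
  (∀ ℓ : ℕ, ℓ.Prime → ℓ ∣ W.conductorNorm ℤ → ℓ ≠ p → ℓ ≠ q → (p : ℤ) ∣ padicValRat ℓ W.Δ) ∧
  (p = 3 → ∃ ℓ : ℕ, ℓ.Prime ∧ ℓ ∣ W.conductorNorm ℤ ∧ ℓ % 3 = 2)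

section Family

variable {W : WeierstrassCurve ℚ} [W.IsElliptic] [W.IsGloballyMinimal] {p q : ℕ} [Fact p.Prime]

/-- The conductor of a member of the twin family is squarefree. [cite: Mazur1977, III Cor. (8.5)] -/
theorem MazurTwinFamilyAt.squarefree_conductor (h : MazurTwinFamilyAt W p q) :
    Squarefree (W.conductorNorm ℤ) := h.1

/-- The Eisenstein prime `q` of a member of the twin family is a prime. [cite: Mazur1977, III Cor. (8.5)] -/
theorem MazurTwinFamilyAt.prime (h : MazurTwinFamilyAt W p q) : q.Prime := h.2.1

/-- `q ≠ p` on the twin family. [cite: Mazur1977, III Cor. (8.5)] -/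
theorem MazurTwinFamilyAt.ne (h : MazurTwinFamilyAt W p q) : q ≠ p := h.2.2.1

/-- `q` divides the conductor on the twin family. [cite: Mazur1977, III Cor. (8.5)] -/
theorem MazurTwinFamilyAt.dvd_conductor (h : MazurTwinFamilyAt W p q) : q ∣ W.conductorNorm ℤ :=
  h.2.2.2.1

/-- `q ≡ 1 (mod p)` on the twin family (Eisenstein type). [cite: Mazur1977, II Prop. (9.7)] -/
theorem MazurTwinFamilyAt.cast_eq_one (h : MazurTwinFamilyAt W p q) : (q : ZMod p) = 1 :=
  h.2.2.2.2.1

/-- At `p = 3`, `q ≡ 1 (mod 9)` on the twin family. [cite: Mazur1977, II Prop. (9.7)] -/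
theorem MazurTwinFamilyAt.cast_eq_one_nine (h : MazurTwinFamilyAt W p q) (hp : p = 3) :
    (q : ZMod 9) = 1 :=
  h.2.2.2.2.2.1 hp

/-- A member of the twin family has a rational point of order `p`. [cite: Mazur1977, III Cor. (8.5)] -/
theorem MazurTwinFamilyAt.dvd_torsionOrder (h : MazurTwinFamilyAt W p q) : p ∣ W.torsionOrder :=
  h.2.2.2.2.2.2.1

/-- A member of the twin family is OFF Greenberg's `μ > 0` locus (no ramified odd line): it is the
étale end of its class. [cite: Mazur1977, III Cor. (8.5)] -/
theorem MazurTwinFamilyAt.not_hasRamifiedOddLineAt (h : MazurTwinFamilyAt W p q) :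
    ¬ HasRamifiedOddLineAt W p :=
  h.2.2.2.2.2.2.2.1

/-- `E[p]` is ramified at `q` on the twin family: `p ∤ v_q(Δ)`. [cite: Mazur1977, III Cor. (8.5)] -/
theorem MazurTwinFamilyAt.not_dvd_padicValRat (h : MazurTwinFamilyAt W p q) :
    ¬ ((p : ℤ) ∣ padicValRat q W.Δ) :=
  h.2.2.2.2.2.2.2.2.1

/-- Hypothesis (Ram_q) on the twin family: `E[p]` is unramified at every bad prime `ℓ ∉ {p, q}`,
i.e. `p ∣ v_ℓ(Δ)`. [cite: Mazur1977, III Cor. (8.5)] -/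
theorem MazurTwinFamilyAt.dvd_padicValRat (h : MazurTwinFamilyAt W p q) {ℓ : ℕ} (hℓ : ℓ.Prime)
    (hℓN : ℓ ∣ W.conductorNorm ℤ) (hℓp : ℓ ≠ p) (hℓq : ℓ ≠ q) : (p : ℤ) ∣ padicValRat ℓ W.Δ :=
  h.2.2.2.2.2.2.2.2.2.1 ℓ hℓ hℓN hℓp hℓq

/-- Yoo's hypothesis (Y) on the twin family at `p = 3`: a prime `≡ 2 (mod 3)` divides the conductor.
[cite: Mazur1977, III Cor. (8.5)] -/
theorem MazurTwinFamilyAt.exists_prime_mod_three (h : MazurTwinFamilyAt W p q) (hp : p = 3) :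
    ∃ ℓ : ℕ, ℓ.Prime ∧ ℓ ∣ W.conductorNorm ℤ ∧ ℓ % 3 = 2 :=
  h.2.2.2.2.2.2.2.2.2.2 hp

end Family

/-! ## §3. The raising set of THEOREM B′ -/

/-- **The raising set of THEOREM B′:** the prime divisors `ℓ` of the conductor with `ℓ ≠ p`, `ℓ ≠ q`
at which `W` has SPLIT multiplicative reduction. MEMO-10 THEOREM B′ asserts
`λ_an(W) = Σ_{ℓ ∈ splitPrimesOutside W p q} sFactor p ℓ` on the twin family with `p` good
(`sFactor p ℓ = p ^ v_p(ℓ^{p−1} − 1) / p`, the `λ` of the raising factor `1 − γ_ℓ`,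
Greenberg–Vatsal 2000 §1 (9)–(10)). Junk: empty when `W.conductorNorm ℤ = 0` (`Nat.divisors 0 = ∅`).
[cite: GreenbergVatsal2000, §1 (9)–(10), §2 Prop. (2.4)] -/
def splitPrimesOutside (W : WeierstrassCurve ℚ) [W.IsElliptic] [W.IsGloballyMinimal] (p q : ℕ) :
    Finset ℕ :=
  (Nat.divisors (W.conductorNorm ℤ)).filter
    (fun ℓ ↦ ℓ ≠ p ∧ ℓ ≠ q ∧
      ∃ hℓ : ℓ.Prime, @WeierstrassCurve.HasSplitMultiplicativeReductionAtPrime W ℓ ⟨hℓ⟩)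

section Raising

variable {W : WeierstrassCurve ℚ} [W.IsElliptic] [W.IsGloballyMinimal] {p q : ℕ}

/-- Membership in the raising set, unfolded. [cite: GreenbergVatsal2000, §1 (9)–(10)] -/
theorem mem_splitPrimesOutside {ℓ : ℕ} :
    ℓ ∈ splitPrimesOutside W p q ↔
      ℓ ∣ W.conductorNorm ℤ ∧ W.conductorNorm ℤ ≠ 0 ∧ ℓ ≠ p ∧ ℓ ≠ q ∧
        ∃ hℓ : ℓ.Prime, @WeierstrassCurve.HasSplitMultiplicativeReductionAtPrime W ℓ ⟨hℓ⟩ := by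
  simp only [splitPrimesOutside, Finset.mem_filter, Nat.mem_divisors, and_assoc]

/-- Every element of the raising set is a prime. [cite: GreenbergVatsal2000, §1 (9)–(10)] -/
theorem prime_of_mem_splitPrimesOutside {ℓ : ℕ} (h : ℓ ∈ splitPrimesOutside W p q) : ℓ.Prime := by
  obtain ⟨-, -, -, -, hℓ, -⟩ := mem_splitPrimesOutside.1 h
  exact hℓ

/-- Every element of the raising set differs from `p` and from `q`.
[cite: GreenbergVatsal2000, §1 (9)–(10)] -/
theorem ne_and_ne_of_mem_splitPrimesOutside {ℓ : ℕ} (h : ℓ ∈ splitPrimesOutside W p q) :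
    ℓ ≠ p ∧ ℓ ≠ q := by
  obtain ⟨-, -, hp, hq, -⟩ := mem_splitPrimesOutside.1 h
  exact ⟨hp, hq⟩

/-- Every element of the raising set divides the conductor and is a prime of split multiplicative
reduction. [cite: GreenbergVatsal2000, §1 (9)–(10)] -/
theorem dvd_and_split_of_mem_splitPrimesOutside {ℓ : ℕ} (h : ℓ ∈ splitPrimesOutside W p q) :
    ℓ ∣ W.conductorNorm ℤ ∧
      ∃ hℓ : ℓ.Prime, @WeierstrassCurve.HasSplitMultiplicativeReductionAtPrime W ℓ ⟨hℓ⟩ := by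
  obtain ⟨hd, -, -, -, hs⟩ := mem_splitPrimesOutside.1 h
  exact ⟨hd, hs⟩

/-- **The bookkeeping hypothesis `hS` of the `Λ`-sockets** (`…AbsoluteCount §2–§4`,
`…NonUnitCount`, `…CompositeCount`): for a prime `p`, every `ℓ` in the raising set is coprime to `p`
and `> 1` (so `ord_T(1 − γ_ℓ mod p) = sFactor p ℓ` applies). [cite: GreenbergVatsal2000, §1 (9)–(10)] -/
theorem coprime_and_one_lt_of_mem_splitPrimesOutside (hp : p.Prime) :
    ∀ ℓ ∈ splitPrimesOutside W p q, p.Coprime ℓ ∧ 1 < ℓ := by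
  intro ℓ hℓ
  have hℓp : ℓ.Prime := prime_of_mem_splitPrimesOutside hℓ
  have hne : ℓ ≠ p := (ne_and_ne_of_mem_splitPrimesOutside hℓ).1
  exact ⟨(Nat.coprime_primes hp hℓp).2 (Ne.symm hne), hℓp.one_lt⟩

/-- The raising set does not contain `p`. [cite: GreenbergVatsal2000, §1 (9)–(10)] -/
theorem not_mem_splitPrimesOutside_self : p ∉ splitPrimesOutside W p q := fun h ↦
  (ne_and_ne_of_mem_splitPrimesOutside h).1 rfl

/-- The raising set does not contain `q`. [cite: GreenbergVatsal2000, §1 (9)–(10)] -/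
theorem not_mem_splitPrimesOutside_right : q ∉ splitPrimesOutside W p q := fun h ↦
  (ne_and_ne_of_mem_splitPrimesOutside h).2 rfl

end Raising

end Summit.BirchSwinnertonDyer.BirchSwinnertonDyer.Theorems.EisensteinPrimesMazurTwinFamily

end
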